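import Summits.BirchSwinnertonDyer.BirchSwinnertonDyer.Theorems.Rank2ShaThetaJet
import Mathlib.Tactic.FieldSimp
import Mathlib.Tactic.LinearCombination
import Mathlib.Tactic.NormNum
import Mathlib.Tactic.Ring
import HarnessLib

/-!
# BirchSwinnertonDyer — rank-2 `Ш[p^∞]` cell, STRUCTURE track: Ramanujan's differential system and its Riccati form on the weight-0 field `ℚ(G, j)` — P-039 «RICCATI»

HONEST FRAMING (cell `b2b-bsdr2sha`, run/shared/lean/b2b/bsd-rank2-sha/; LEAD g15's T28 offer HOME/INBOX.md l.1213, 2026-08-25, base drafts 226a320d… / v2 f2ae2d74…,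
with P2 g12's folds (a) T21 link, (b) order q²⁴, (c) Δ from the product — INBOX l.1215; structure/P-039.md card
875994a5… and its exact-side helper riccati39.py fe9ded51… (`selftest`); THEORY-NOTE-C5 §31.1): the EXACT, CHARACTERISTIC-ZERO ALGEBRA behind P-039
ONLY. P-039 registers 1 368 `p`-adic law instances («the frozen instrument's reading `G(E) = E₂E₄E₆/Δ` of an ordinary curve is the Taylor jet at the
CM point of the solution of (R) seeded with Katz's CM value»); NOTHING in this file depends on, or speaks to, those `p`-adic readings, the CM values, or
THEOREM-candidate V.

* THE ALGEBRA [`riccati_cleared`, `riccati`]. In any commutative ring, if `D` is additive-Leibniz data on `E₂, E₄, E₆` satisfying RAMANUJAN'S SYSTEM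
  `12·D E₂ = E₂² − E₄`, `3·D E₄ = E₂E₄ − E₆`, `2·D E₆ = E₂E₆ − E₄²`, then `12·E₄E₆·D(E₂E₄E₆) = 11E₂²E₄²E₆² − E₄³E₆² − 4E₂E₄E₆³ − 6E₂E₄⁴E₆`
  (`linear_combination`, the coefficients displayed in the proof); and over a field with `12 ≠ 0`, `Δ := (E₄³ − E₆²)/1728 ≠ 0`, `E₄E₆ ≠ 0`, the
  quotient-rule derivatives of `j := E₄³/Δ` and `G := E₂E₄E₆/Δ` satisfy the RICCATI EQUATION of the card,
  `12·j·(j − 1728)·DG = Dj·( j(j − 1728) + 4(j − 1728)G + 6jG + G² )`, i.e. `dG/dj = 1/12 + G/(3j) + G/(2(j − 1728)) + G²/(12j(j − 1728))`;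
  and [`G_eq_theta2_j`] `G = 7j − 6912 − 6·θ²j/E₄` (`E₄ ≠ 0`), the form in which the CM values of P-033/P-037/P-038 are read.
* THE LINK TO T21 [`D_PQR`, `riccati_cleared_D`, `D_GS`, `D_JS`, `JS_sub_JmS`, `riccati_D`, `theta2_j_D`]. The same two identities HYPOTHESIS-FREE in the ring
  `ℤ[P,Q,R,S]` of `Rank2ShaThetaJet` (T21; `P = E₂`, `Q = E₄`, `R = E₆`, `S` read `Δ⁻¹`), whose Mathlib `Derivation` `D = 12θ` has Ramanujan's system
  built in: `QR·D(PQR) = 11P²Q²R² − …` and, with `GS = PQRS`, `JS = Q³S` (`j`), `JmS = R²S` (`j − 1728`, as `JS − JmS = S·(Q³ − R²) ↦ 1728`),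
  `12·JS·JmS·D(GS) = D(JS)·(JS·JmS + 4·JmS·GS + 6·JS·GS + GS²)` as a polynomial identity (`ring`), no relation and no field needed.
  Likewise `−12·D(Q²RS) = 24·Q·(7·JS − 4·S(Q³ − R²) − GS)` (`144θ²j = …`), the twin of `G_eq_theta2_j`.
* THE NUMBERS [`ramanujan₂`, `ramanujan₄`, `ramanujan₆`, `delta_eq`, `theta_delta`, `riccati_qexp`]. With the integer `q`-expansions of `E₂, E₄, E₆`
  truncated to 25 coefficients (`1 − 24Σσ₁(n)qⁿ`, `1 + 240Σσ₃(n)qⁿ`, `1 − 504Σσ₅(n)qⁿ`, the divisor sums typed as literal tables and re-derived from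
  `σ_k` by `decide`) and `θ = q·d/dq` acting coefficientwise, Ramanujan's three identities, `E₄³ − E₆² = 1728Δ` with `Δ = q − 24q² + 252q³ − …`,
  `θΔ = E₂Δ`, and the cleared Riccati identity hold COEFFICIENTWISE to order `q²⁴` (`decide` on lists of `ℤ`; the largest coefficient met has 29 digits)
  — the Lean twin of riccati39.py's `selftest` (13 coefficients there); Euler's product `∏(1 − qⁿ)` (pentagonal numbers) and
  `Δ = q·∏(1 − qⁿ)²⁴` are ALSO computed from the product and agree with the `τ`-table [`delta_product`].

NOT TYPED: that these lists ARE modular forms, convergence, Katz's `p`-adic `E₂`, the `q`-expansion principle, CM values, canonical lifts, every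
census number; nothing here concerns BSD, `Ш`, heights or `L`-values. No named fact, no axiom, no `sorry`; `def`s are computable bookkeeping over `ℤ`.
References: S. Ramanujan, «On certain arithmetical functions», Trans. Cambridge Philos. Soc. 22 (1916) 159–184, eq. (30); structure/P-039.md;
riccati39.py; THEORY-NOTE-C5 §31; T21 `Rank2ShaThetaJet` (the derivation `D = 12θ` on `ℤ[P,Q,R,S]`).
-/

set_option autoImplicit false

-- single-conjunct summit: `Summit.BirchSwinnertonDyer.BirchSwinnertonDyer.…` repeats the name by design
set_option linter.dupNamespace false

namespace Summit.BirchSwinnertonDyer.BirchSwinnertonDyer.Rank2Sha.Structure.RamanujanRiccati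

/-! ## The algebra: Ramanujan's system ⇒ the cleared Riccati identity ⇒ the Riccati equation -/

/-- **Cleared Riccati identity.** In any commutative ring: if `d₂, d₄, d₆` (the values of a derivation on `E₂, E₄, E₆`) satisfy Ramanujan's
system, then `12·E₄E₆·D(E₂E₄E₆) = 11E₂²E₄²E₆² − E₄³E₆² − 4E₂E₄E₆³ − 6E₂E₄⁴E₆`, where `D(E₂E₄E₆) = d₂E₄E₆ + E₂d₄E₆ + E₂E₄d₆` (Leibniz). -/
theorem riccati_cleared {R : Type*} [CommRing R] (E₂ E₄ E₆ d₂ d₄ d₆ : R)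
    (h₂ : 12 * d₂ = E₂ ^ 2 - E₄) (h₄ : 3 * d₄ = E₂ * E₄ - E₆) (h₆ : 2 * d₆ = E₂ * E₆ - E₄ ^ 2) :
    12 * E₄ * E₆ * (d₂ * E₄ * E₆ + E₂ * d₄ * E₆ + E₂ * E₄ * d₆) =
      11 * E₂ ^ 2 * E₄ ^ 2 * E₆ ^ 2 - E₄ ^ 3 * E₆ ^ 2 - 4 * E₂ * E₄ * E₆ ^ 3 - 6 * E₂ * E₄ ^ 4 * E₆ := by
  linear_combination (E₄ ^ 2 * E₆ ^ 2) * h₂ + (4 * E₂ * E₄ * E₆ ^ 2) * h₄ + (6 * E₂ * E₄ ^ 2 * E₆) * h₆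

/-- `Δ := (E₄³ − E₆²)/1728`. -/
def Delta {K : Type*} [Field K] (E₄ E₆ : K) : K := (E₄ ^ 3 - E₆ ^ 2) / 1728

/-- `j := E₄³/Δ`. -/
def jInv {K : Type*} [Field K] (E₄ E₆ : K) : K := E₄ ^ 3 / Delta E₄ E₆

/-- `G := E₂E₄E₆/Δ`, the weight-0 read-out of the instrument. -/
def G {K : Type*} [Field K] (E₂ E₄ E₆ : K) : K := E₂ * E₄ * E₆ / Delta E₄ E₆

/-- `DΔ := (3E₄²d₄ − 2E₆d₆)/1728` (Leibniz). -/
def dDelta {K : Type*} [Field K] (E₄ E₆ d₄ d₆ : K) : K := (3 * E₄ ^ 2 * d₄ - 2 * E₆ * d₆) / 1728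

/-- `Dj := (3E₄²d₄·Δ − E₄³·DΔ)/Δ²` (quotient rule). -/
def dj {K : Type*} [Field K] (E₄ E₆ d₄ d₆ : K) : K :=
  (3 * E₄ ^ 2 * d₄ * Delta E₄ E₆ - E₄ ^ 3 * dDelta E₄ E₆ d₄ d₆) / Delta E₄ E₆ ^ 2

/-- `DG := ((d₂E₄E₆ + E₂d₄E₆ + E₂E₄d₆)·Δ − E₂E₄E₆·DΔ)/Δ²` (Leibniz + quotient rule). -/
def dG {K : Type*} [Field K] (E₂ E₄ E₆ d₂ d₄ d₆ : K) : K :=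
  ((d₂ * E₄ * E₆ + E₂ * d₄ * E₆ + E₂ * E₄ * d₆) * Delta E₄ E₆ - E₂ * E₄ * E₆ * dDelta E₄ E₆ d₄ d₆) / Delta E₄ E₆ ^ 2

/-- **`θΔ = E₂·Δ`** follows from Ramanujan's system (any field with `1728 ≠ 0` — here: characteristic zero). -/
theorem dDelta_eq {K : Type*} [Field K] [CharZero K] (E₂ E₄ E₆ d₄ d₆ : K)
    (h₄ : 3 * d₄ = E₂ * E₄ - E₆) (h₆ : 2 * d₆ = E₂ * E₆ - E₄ ^ 2) :
    dDelta E₄ E₆ d₄ d₆ = E₂ * Delta E₄ E₆ := by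
  have e₄ : d₄ = (E₂ * E₄ - E₆) / 3 := by field_simp; linear_combination h₄
  have e₆ : d₆ = (E₂ * E₆ - E₄ ^ 2) / 2 := by field_simp; linear_combination h₆
  simp only [dDelta, Delta, e₄, e₆]
  field_simp
  ring

/-- **`θj = −E₄²E₆/Δ`** follows from Ramanujan's system (characteristic zero, `Δ ≠ 0`). -/
theorem dj_eq {K : Type*} [Field K] [CharZero K] (E₂ E₄ E₆ d₄ d₆ : K)
    (h₄ : 3 * d₄ = E₂ * E₄ - E₆) (h₆ : 2 * d₆ = E₂ * E₆ - E₄ ^ 2) (hΔ : Delta E₄ E₆ ≠ 0) :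
    dj E₄ E₆ d₄ d₆ = -(E₄ ^ 2 * E₆) / Delta E₄ E₆ := by
  have e₄ : d₄ = (E₂ * E₄ - E₆) / 3 := by field_simp; linear_combination h₄
  have e₆ : d₆ = (E₂ * E₆ - E₄ ^ 2) / 2 := by field_simp; linear_combination h₆
  have hΔ' : E₄ ^ 3 - E₆ ^ 2 ≠ 0 := by
    intro h; apply hΔ; simp [Delta, h]
  simp only [dj, dDelta, Delta, e₄, e₆]
  field_simp
  ring

/-- **THE RICCATI EQUATION (R) of P-039**, cleared form: `12·j·(j − 1728)·DG = Dj·(j(j − 1728) + 4(j − 1728)G + 6jG + G²)` — i.e.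
`dG/dj = 1/12 + G/(3j) + G/(2(j − 1728)) + G²/(12j(j − 1728))` wherever `Dj ≠ 0` — for ANY derivation satisfying Ramanujan's system
(characteristic zero, `Δ ≠ 0`). -/
theorem riccati {K : Type*} [Field K] [CharZero K] (E₂ E₄ E₆ d₂ d₄ d₆ : K)
    (h₂ : 12 * d₂ = E₂ ^ 2 - E₄) (h₄ : 3 * d₄ = E₂ * E₄ - E₆) (h₆ : 2 * d₆ = E₂ * E₆ - E₄ ^ 2) (hΔ : Delta E₄ E₆ ≠ 0) :
    12 * jInv E₄ E₆ * (jInv E₄ E₆ - 1728) * dG E₂ E₄ E₆ d₂ d₄ d₆ =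
      dj E₄ E₆ d₄ d₆ * (jInv E₄ E₆ * (jInv E₄ E₆ - 1728) + 4 * (jInv E₄ E₆ - 1728) * G E₂ E₄ E₆
        + 6 * jInv E₄ E₆ * G E₂ E₄ E₆ + G E₂ E₄ E₆ ^ 2) := by
  have e₂ : d₂ = (E₂ ^ 2 - E₄) / 12 := by field_simp; linear_combination h₂
  have e₄ : d₄ = (E₂ * E₄ - E₆) / 3 := by field_simp; linear_combination h₄
  have e₆ : d₆ = (E₂ * E₆ - E₄ ^ 2) / 2 := by field_simp; linear_combination h₆
  have hΔ' : E₄ ^ 3 - E₆ ^ 2 ≠ 0 := by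
    intro h; apply hΔ; simp [Delta, h]
  simp only [jInv, G, dG, dj, dDelta, Delta, e₂, e₄, e₆]
  field_simp
  ring

/-- `D(θj)` computed from `θj = −E₄²E₆/Δ` (`dj_eq`) by Leibniz and the quotient rule: `(−(2E₄d₄E₆ + E₄²d₆)·Δ + E₄²E₆·DΔ)/Δ²`. -/
def dThetaJ {K : Type*} [Field K] (E₄ E₆ d₄ d₆ : K) : K :=
  (-(2 * E₄ * d₄ * E₆ + E₄ ^ 2 * d₆) * Delta E₄ E₆ + E₄ ^ 2 * E₆ * dDelta E₄ E₆ d₄ d₆) / Delta E₄ E₆ ^ 2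

/-- **`G = 7j − 6912 − 6·θ²j/E₄`**: the weight-0 read-out is an affine function of `j` minus six times the SECOND `θ`-derivative of `j`
divided by `E₄` (Ramanujan's system; characteristic zero, `Δ ≠ 0`, `E₄ ≠ 0`). With `E₂` replaced by `E₂* = E₂ − 3/(π Im τ)` and `θ²` by
the Maass–Shimura `∂₂∂₀` this is the form in which the CM values `g*(τ)` of P-033/P-037/P-038 are «algebraic parts of derivatives of `j`». -/
theorem G_eq_theta2_j {K : Type*} [Field K] [CharZero K] (E₂ E₄ E₆ d₄ d₆ : K)
    (h₄ : 3 * d₄ = E₂ * E₄ - E₆) (h₆ : 2 * d₆ = E₂ * E₆ - E₄ ^ 2) (hΔ : Delta E₄ E₆ ≠ 0) (hE₄ : E₄ ≠ 0) :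
    G E₂ E₄ E₆ = 7 * jInv E₄ E₆ - 6912 - 6 * dThetaJ E₄ E₆ d₄ d₆ / E₄ := by
  have e₄ : d₄ = (E₂ * E₄ - E₆) / 3 := by field_simp; linear_combination h₄
  have e₆ : d₆ = (E₂ * E₆ - E₄ ^ 2) / 2 := by field_simp; linear_combination h₆
  have hΔ' : E₄ ^ 3 - E₆ ^ 2 ≠ 0 := by
    intro h; apply hΔ; simp [Delta, h]
  simp only [G, jInv, dThetaJ, dDelta, Delta, e₄, e₆]
  field_simp
  ring


/-! ## The link to T21: the same identities in `ℤ[P,Q,R,S]` with the derivation `D = 12θ` of `Rank2ShaThetaJet` -/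

section T21Link

open MvPolynomial
open Summit.BirchSwinnertonDyer.BirchSwinnertonDyer.Rank2Sha.Structure.ThetaJet

/-- **`12θ(E₂E₄E₆)` in T21's ring** (`P = E₂`, `Q = E₄`, `R = E₆`, `D = 12θ` the Mathlib `Derivation` of T21 with `DP = P² − Q`,
`DQ = 4(PQ − R)`, `DR = 6(PR − Q²)`): `D(PQR) = 11P²QR − Q²R − 4PR² − 6PQ³` (Leibniz, then `ring`). -/
theorem D_PQR : D (X .P * X .Q * X .R) =
    11 * X .P ^ 2 * X .Q * X .R - X .Q ^ 2 * X .R - 4 * X .P * X .R ^ 2 - 6 * X .P * X .Q ^ 3 := by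
  simp only [Derivation.leibniz, D_P, D_Q, D_R, smul_eq_mul]
  ring

/-- **`riccati_cleared` in T21's ring**, hypothesis-free (Ramanujan's system is built into `D`): `QR·D(PQR) = 11P²Q²R² − Q³R² − 4PQR³ − 6PQ⁴R`. -/
theorem riccati_cleared_D : X .Q * X .R * D (X .P * X .Q * X .R) =
    11 * X .P ^ 2 * X .Q ^ 2 * X .R ^ 2 - X .Q ^ 3 * X .R ^ 2 - 4 * X .P * X .Q * X .R ^ 3 - 6 * X .P * X .Q ^ 4 * X .R := by
  rw [D_PQR]
  ring

/-- `GS := PQRS`, read `G = E₂E₄E₆/Δ` on `S = Δ⁻¹`. -/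
noncomputable def GS : R₄ := X .P * X .Q * X .R * X .S
/-- `JS := Q³S`, read `j = E₄³/Δ` on `S = Δ⁻¹` (T21's `j`). -/
noncomputable def JS : R₄ := X .Q * X .Q * X .Q * X .S
/-- `JmS := R²S`, read `j − 1728 = E₆²/Δ` on `S = Δ⁻¹`. -/
noncomputable def JmS : R₄ := X .R * X .R * X .S

/-- `JS − JmS = S·(Q³ − R²)` (`= S·1728Δ`, i.e. `1728` on `S = Δ⁻¹`; by T21's `D_S_mul_discr` the element `S·(Q³ − R²)` is a `D`-constant, so
`D` descends to the quotient by `S·(Q³ − R²) − 1728`). -/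
theorem JS_sub_JmS : JS - JmS = X .S * discr := by
  simp only [JS, JmS, discr]
  ring

/-- `D(GS) = −S·(P²QR + Q²R + 4PR² + 6PQ³)`, i.e. `12θG = −(E₂²E₄E₆ + E₄²E₆ + 4E₂E₆² + 6E₂E₄³)/Δ`. -/
theorem D_GS : D GS = -(X .S * (X .P ^ 2 * X .Q * X .R + X .Q ^ 2 * X .R + 4 * X .P * X .R ^ 2 + 6 * X .P * X .Q ^ 3)) := by
  simp only [GS, Derivation.leibniz, D_P, D_Q, D_R, D_S, smul_eq_mul]
  ring

/-- `D(JS) = −12·Q²RS` (T21's `D_j`: `θj = −E₄²E₆/Δ`, cf. `dj_eq`). -/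
theorem D_JS : D JS = -(12 * (X .Q ^ 2 * X .R * X .S)) := by
  simp only [JS, Derivation.leibniz, D_Q, D_S, smul_eq_mul]
  ring

/-- **The Riccati equation in T21's ring**, hypothesis-free and relation-free: `12·JS·JmS·D(GS) = D(JS)·(JS·JmS + 4·JmS·GS + 6·JS·GS + GS²)` in
`ℤ[P,Q,R,S]` — the polynomial identity behind `riccati` (there over a field, with `j − 1728` for `JmS`). -/
theorem riccati_D : 12 * JS * JmS * D GS = D JS * (JS * JmS + 4 * JmS * GS + 6 * JS * GS + GS ^ 2) := by
  rw [D_GS, D_JS]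
  simp only [GS, JS, JmS]
  ring

/-- **`G = 7j − 6912 − 6·θ²j/E₄` in T21's ring**, hypothesis-free: with `θj = −Q²RS` (`D_JS`) one has `144·θ²j = −12·D(Q²RS)`, and
`−12·D(Q²RS) = 24·Q·(7·JS − 4·S(Q³ − R²) − GS)` as polynomials (T21's `D_QQRS`, then `ring`); on `S = Δ⁻¹`, where `S(Q³ − R²) = 1728`, this reads
`6·θ²j = E₄·(7j − 6912 − G)` — the relation-free twin of `G_eq_theta2_j`. -/
theorem theta2_j_D : -(12 * D (X .Q * X .Q * X .R * X .S)) = 24 * X .Q * (7 * JS - 4 * (X .S * discr) - GS) := by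
  rw [D_QQRS]
  simp only [JS, GS, discr]
  ring

end T21Link

/-! ## The numbers: truncated integer `q`-expansions (25 coefficients, order `q²⁴`) -/

/-- Truncation order: coefficients of `q⁰ … q²⁴`. -/
def N : ℕ := 25

/-- `σ_k(n) = Σ_{d ∣ n} dᵏ` (`n ≥ 1`), computable. -/
def sigma (k n : ℕ) : ℕ := ((List.range (n + 1)).filter fun d => 0 < d ∧ n % d = 0).foldr (fun d s => d ^ k + s) 0

/-- `E₂ = 1 − 24 Σ σ₁(n) qⁿ`, 25 coefficients (literal table). -/
def e₂ : List ℤ := [1, -24, -72, -96, -168, -144, -288, -192, -360, -312, -432, -288, -672, -336, -576, -576, -744, -432, -936, -480, -1008, -768,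
  -864, -576, -1440]

/-- `E₄ = 1 + 240 Σ σ₃(n) qⁿ`, 25 coefficients (literal table). -/
def e₄ : List ℤ := [1, 240, 2160, 6720, 17520, 30240, 60480, 82560, 140400, 181680, 272160, 319680, 490560, 527520, 743040, 846720, 1123440,
  1179360, 1635120, 1646400, 2207520, 2311680, 2877120, 2920320, 3931200]

/-- `E₆ = 1 − 504 Σ σ₅(n) qⁿ`, 25 coefficients (literal table). -/
def e₆ : List ℤ := [1, -504, -16632, -122976, -532728, -1575504, -4058208, -8471232, -17047800, -29883672, -51991632, -81170208, -129985632,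
  -187132176, -279550656, -384422976, -545530104, -715608432, -986161176, -1247954400, -1665307728, -2066980608, -2678616864, -3243917376,
  -4159663200]

/-- `Δ = q ∏ (1 − qⁿ)²⁴ = Σ τ(n) qⁿ`, 25 coefficients (literal table of Ramanujan's `τ`, `n ≤ 24`). -/
def delta : List ℤ := [0, 1, -24, 252, -1472, 4830, -6048, -16744, 84480, -113643, -115920, 534612, -370944, -577738, 401856, 1217160, 987136,
  -6905934, 2727432, 10661420, -7109760, -4219488, -12830688, 18643272, 21288960]

/-- The tables ARE the divisor sums: `e₂[n] = −24σ₁(n)`, `e₄[n] = 240σ₃(n)`, `e₆[n] = −504σ₅(n)` for `1 ≤ n ≤ 24`, leading coefficients `1`. -/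
theorem tables_eq_sigma :
    e₂ = 1 :: (List.range 24).map (fun i => -24 * (sigma 1 (i + 1) : ℤ)) ∧
    e₄ = 1 :: (List.range 24).map (fun i => 240 * (sigma 3 (i + 1) : ℤ)) ∧
    e₆ = 1 :: (List.range 24).map (fun i => -504 * (sigma 5 (i + 1) : ℤ)) := by
  refine ⟨?_, ?_, ?_⟩ <;> decide +kernel

/-- Coefficient access with zero padding. -/
def cf (a : List ℤ) (n : ℕ) : ℤ := a.getD n 0

/-- Truncated product (Cauchy product to order `N`). -/
def mul (a b : List ℤ) : List ℤ :=
  (List.range N).map fun n => ((List.range (n + 1)).map fun i => cf a i * cf b (n - i)).foldr (· + ·) 0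

/-- Coefficientwise sum, truncated to order `N`. -/
def add (a b : List ℤ) : List ℤ := (List.range N).map fun n => cf a n + cf b n

/-- Coefficientwise difference, truncated to order `N`. -/
def sub (a b : List ℤ) : List ℤ := (List.range N).map fun n => cf a n - cf b n

/-- Scalar multiple, truncated to order `N`. -/
def smul (c : ℤ) (a : List ℤ) : List ℤ := (List.range N).map fun n => c * cf a n

/-- `θ = q d/dq`: multiplies the `n`-th coefficient by `n`. -/
def theta (a : List ℤ) : List ℤ := (List.range N).map fun n : ℕ => (Int.ofNat n) * cf a n

/-- **Ramanujan (1916), `12·θE₂ = E₂² − E₄`**, coefficientwise to order `q²⁴`. -/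
theorem ramanujan₂ : smul 12 (theta e₂) = sub (mul e₂ e₂) e₄ := by decide +kernel

/-- **Ramanujan (1916), `3·θE₄ = E₂E₄ − E₆`**, coefficientwise to order `q²⁴`. -/
theorem ramanujan₄ : smul 3 (theta e₄) = sub (mul e₂ e₄) e₆ := by decide +kernel

/-- **Ramanujan (1916), `2·θE₆ = E₂E₆ − E₄²`**, coefficientwise to order `q²⁴`. -/
theorem ramanujan₆ : smul 2 (theta e₆) = sub (mul e₂ e₆) (mul e₄ e₄) := by decide +kernel

/-- **`E₄³ − E₆² = 1728·Δ`**, coefficientwise to order `q²⁴`. -/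
theorem delta_eq : sub (mul (mul e₄ e₄) e₄) (mul e₆ e₆) = smul 1728 delta := by decide +kernel

/-- **`θΔ = E₂·Δ`**, coefficientwise to order `q²⁴`. -/
theorem theta_delta : theta delta = mul e₂ delta := by decide +kernel

/-- **The cleared Riccati identity on `q`-expansions**: `12·E₄E₆·θ(E₂E₄E₆) = 11E₂²E₄²E₆² − E₄³E₆² − 4E₂E₄E₆³ − 6E₂E₄⁴E₆`, coefficientwise to
order `q²⁴` (riccati39.py's `selftest` in Lean, 13 coefficients there; the largest coefficient met has 29 digits). -/
theorem riccati_qexp :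
    smul 12 (mul (mul e₄ e₆) (theta (mul (mul e₂ e₄) e₆))) =
      sub (sub (sub (smul 11 (mul (mul (mul e₂ e₄) e₆) (mul (mul e₂ e₄) e₆)))
        (mul (mul (mul e₄ e₄) e₄) (mul e₆ e₆)))
        (smul 4 (mul e₂ (mul e₄ (mul e₆ (mul e₆ e₆))))))
        (smul 6 (mul e₂ (mul (mul (mul e₄ e₄) (mul e₄ e₄)) e₆))) := by
  decide +kernel

/-- Truncated power (iterated `mul`). -/
def npow (a : List ℤ) : ℕ → List ℤ
  | 0 => (List.range N).map fun n => if n = 0 then 1 else 0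
  | k + 1 => mul (npow a k) a

/-- Euler's product `∏_{n=1}^{24} (1 − qⁿ)`, truncated to order `N` (computed, not tabulated). -/
def euler : List ℤ :=
  (List.range 24).foldl (fun acc i => mul acc ((List.range N).map fun m => if m = 0 then 1 else if m = i + 1 then -1 else 0))
    ((List.range N).map fun n => if n = 0 then 1 else 0)

/-- Euler's pentagonal number theorem, to order `q²⁴`: `∏(1 − qⁿ) ≡ 1 − q − q² + q⁵ + q⁷ − q¹² − q¹⁵ + q²² (mod q²⁵)`. -/
theorem euler_pentagonal : euler = [1, -1, -1, 0, 0, 1, 0, 1, 0, 0, 0, 0, -1, 0, 0, -1, 0, 0, 0, 0, 0, 0, 1, 0, 0] := by decide +kernel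

/-- **`Δ = q·∏(1 − qⁿ)²⁴`**: the PRODUCT, truncated to order `q²⁴`, reproduces the `τ`-table `delta` (so `delta_eq` checks `E₄³ − E₆² = 1728·q∏(1 − qⁿ)²⁴`
against an independently computed right-hand side). -/
theorem delta_product : mul ((List.range N).map fun n => if n = 1 then 1 else 0) (npow euler 24) = delta := by decide +kernel

end Summit.BirchSwinnertonDyer.BirchSwinnertonDyer.Rank2Sha.Structure.RamanujanRiccati
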